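import Literature.NumberTheory.GaloisRepresentations.TriangulineVariety

/-!
# At most one seeded chamber per torsion type: the predicate `IrredChamberAt`

Definition item `defn-IrredChamberAt` (topic `Literature/NumberTheory/GaloisRepresentations`),
wanted by route `Langlands/TriangulineChamber` to type its cruxes `IrredChamberGL2` (`IRR''`) and
`ChamberQpIrreducible` and the supports `ChamberQpNonsplit`, `ChamberQpSplit`, `BHSChamberAssembly`.

## Mathematics

Let `K/ℚ_p` be finite, `ρ̄ : 𝒢_K → GL_n(k_L)` and `X_tri^□(ρ̄) ⊂ 𝔛^□_ρ̄ × 𝒯ⁿ_L` the trianguline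
variety of Breuil–Hellmann–Schraen (the Zariski closure of `U_tri^□(ρ̄)^reg`, reduced;
equidimensional, with `U_tri^□(ρ̄)^reg` Zariski-open dense and smooth).
[cite: BreuilHellmannSchraen2017Trianguline, Déf. 2.4 and Th. 2.6]
The connected components of `𝒯ⁿ_L` are indexed by the torsion types
`t ∈ Hom(μ(K), Lˣ)ⁿ`, and every irreducible component `C` of `X_tri^□(ρ̄)` lies over a single `t`
(accepted `TriangulineVariety.exists_subset_typeStratum_of_mem_irreducibleComponents`).  Write `Z_B`
for the Zariski closure of the Borel-valued points `(r, δ_taut(r))` (accepted `IsBorelValuedAt`).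
A *seed* is a point `x ∈ U_tri^□(ρ̄)^reg` with `r_x` crystalline, `τ`-Hodge–Tate regular for every
`τ`, `δ_x` locally algebraic of strictly dominant weight, and `φ`-generic
(`φ_iφ_j⁻¹ ∉ {1, q}`) — the crystalline strictly dominant (non-companion) classical points.
[cite: BreuilHellmannSchraen2017Trianguline, Déf. 2.8 and Lemme 2.11]
[cite: BreuilHellmannSchraen2019, §1]

The route's corrected crux `IRR''(ρ̄, t)` ("one chamber per type") asserts: **among the irreducible
components `C ⊆ X_t` of `X_tri^□(ρ̄)` not contained in `Z_B`, at most one contains a seed.**  Over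
the accepted interface `X : TriangulineVariety K p O k ρ̄` (file `TriangulineVariety.lean`, whose
module docstring displays exactly this formula) it is the predicate

  `{C ∈ irreducibleComponents X.Pt | C ⊆ X.typeStratum t ∧ ¬ C ⊆ closure {x | X.IsBorelValuedAt d x} ∧
    ∃ x ∈ C ∩ X.regular, X.IsCrystallineAt 𝔇 x ∧ X.IsHodgeTateRegularAt 𝔇 x ∧
      X.IsStrictlyDominantAt x ∧ X.IsPhiGenericAt 𝔇 x}.Subsingleton`.

## What this file provides

* `TriangulineVariety.IrredChamberAt X d 𝔇 t : Prop` — the displayed formula VERBATIM, with the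
  datum `X` an explicit argument, exactly like the accepted property predicates `BorelLocusClopen`,
  `RegularIsOpenDense`, `PointsOfRegular`: a property a given datum may or may not have, consumed
  hypothesis-relatively as `(hIRR : ∀ t, X.IrredChamberAt d 𝔇 t)`.
* Unfolding: `irredChamberAt_iff` (`Iff.rfl`), `irredChamberAt_iff_forall_eq` (pairwise form) and
  the elimination rule `IrredChamberAt.eq`.
* `subset_typeStratum_iff_torsionType_eq`: a component lies in `X_t` iff one (any) of its points
  has torsion type `t` — "the type of a chamber is the type of its seed".
* Vacuity: `irredChamberAt_of_forall_not_seed` (no seed of type `t`),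
  `irredChamberAt_of_typeStratum_eq_empty` (empty stratum — e.g. the determinant-incompatible
  types of `ChamberQpIrreducible`), `irredChamberAt_of_typeStratum_subset_closure` (`X_t ⊆ Z_B`),
  `irredChamberAt_of_subsingleton` (at most one component over `t` at all) and
  `irredChamberAt_of_isPreirreducible_typeStratum` (`X_t` irreducible or empty).
* Under `X.BorelLocusClopen d` (the route's `OrdinaryComponent`), via the accepted dichotomy
  `subset_or_disjoint_of_borelLocusClopen`: `not_subset_closure_iff_disjoint_of_borelLocusClopen`
  and the reformulations `irredChamberAt_iff_of_borelLocusClopen` (at most one component of type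
  `t` DISJOINT from `Z_B` carrying a seed) and `irredChamberAt_iff_slope_of_borelLocusClopen` (at
  most one component of type `t` carrying a seed of positive slope, `¬ IsSlopeZeroAt`); and when
  there are no Borel-valued points at all (`ρ̄` irreducible: `Z_B = ∅`),
  `irredChamberAt_iff_of_forall_not_isBorelValuedAt` drops the `Z_B`-clause.

## Design notes

* **A predicate, never a closed fact.**  No `_holds` companion and no `∀ X …` / `∃ X …` closure is
  (or may be) filed: over the bare interface every
  `∀ X : TriangulineVariety …, IsEquidimensional → RegularIsOpenDense → PointsOfRegular 𝔇 →
  HasAllRegularPoints 𝔇 → BorelLocusClopen d → (∀ t, X.IrredChamberAt d 𝔇 t)` is refutable by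
  re-topologising a datum, and every `∃ X` form holds vacuously (refuter evidence
  `JunkRetopologize.lean` on item `stmt-Langlands-8599`).  A closed statement of `IrredChamberGL2` /
  `ChamberQpIrreducible` needs in addition a characterisation of the GENUINE BHS space (points and
  analytic Zariski topology), i.e. rigid-analytic geometry — deliberately NOT here.
* Non-emptiness ("every relevant type carries a seeded chamber") is NOT part of the predicate: it
  is the route's separate support `TypeSeeds`; `Set.Subsingleton` says "at most one".
* No new vocabulary is introduced besides the predicate itself: the seed condition is spelled out
  in every statement exactly as displayed, so that each lemma can be compared textually with the
  crux.

## References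

* C. Breuil, E. Hellmann, B. Schraen, *Une interprétation modulaire de la variété trianguline*,
  Math. Ann. 367 (2017), arXiv:1411.7260, §2.2 (Déf. 2.4, Th. 2.6, Déf. 2.8, Lemme 2.11).
  [BreuilHellmannSchraen2017Trianguline]
* C. Breuil, E. Hellmann, B. Schraen, *A local model for the trianguline variety and applications*,
  Publ. Math. IHÉS 130 (2019), arXiv:1702.02192, §1. [BreuilHellmannSchraen2019]
* B. Conrad, *Irreducible components of rigid spaces*, Ann. Inst. Fourier 49 (1999), §2.2.
  [Conrad1999]
-/

namespace Literature.NumberTheory.GaloisRepresentations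

namespace TriangulineVariety

variable {K : Type} [Field K] [ValuativeRel K] [TopologicalSpace K] [IsNonarchimedeanLocalField K]
  {p : ℕ} [Fact p.Prime] {O : Type} [CommRing O] [Algebra O (PadicAlgCl p)] {k : Type} [Field k]
  [Algebra O k] [TopologicalSpace k] {n : ℕ} {ρbar : ModPGaloisRep K k n}
  (X : TriangulineVariety K p O k ρbar)

/-! #### The predicate -/

/-- **At most one seeded chamber of type `t` (`IRR''`, "one chamber per type").**  For a
trianguline-variety datum `X` (the accepted interface of `X_tri^□(ρ̄)`, BHS Déf. 2.4 / Th. 2.6), a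
local Artin datum `d` (normalising the Borel-valued locus `Z_B = closure {x | X.IsBorelValuedAt d x}`),
a `p`-adic Hodge datum `𝔇` (through which "crystalline", "Hodge–Tate regular", "`φ`-generic" are
read) and a torsion type `t ∈ Hom(μ(K), ℚ̄_pˣ)ⁿ`: the set of irreducible components `C` of `X.Pt`
(analytic Zariski topology) with `C ⊆ X_t`, `C ⊄ Z_B`, and containing a *seed* — a point
`x ∈ C ∩ U^reg` with `r_x` crystalline, Hodge–Tate regular, `δ_x` locally algebraic strictly
dominant, `φ`-generic — has at most one element.  This is VERBATIM the formula displayed in the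
module docstring of `TriangulineVariety.lean`; it is the corrected crux of route
`Langlands/TriangulineChamber` (a hypothesis on a datum, consumed as
`(hIRR : ∀ t, X.IrredChamberAt d 𝔇 t)`), not a statement of BHS, and it has no `_holds`
companion (see the module docstring). [folklore] -/
def IrredChamberAt (d : LocalArtinData K) (𝔇 : PstWeilDeligneData K p)
    (t : Fin n → (CommGroup.torsion Kˣ →* (PadicAlgCl p)ˣ)) : Prop :=
  {C ∈ irreducibleComponents X.Pt | C ⊆ X.typeStratum t ∧ ¬ C ⊆ closure {x | X.IsBorelValuedAt d x} ∧
    ∃ x ∈ C ∩ X.regular, X.IsCrystallineAt 𝔇 x ∧ X.IsHodgeTateRegularAt 𝔇 x ∧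
      X.IsStrictlyDominantAt x ∧ X.IsPhiGenericAt 𝔇 x}.Subsingleton

section Unfolding

variable (d : LocalArtinData K) (𝔇 : PstWeilDeligneData K p)
  (t : Fin n → (CommGroup.torsion Kˣ →* (PadicAlgCl p)ˣ))

/-- Unfolding lemma for `IrredChamberAt`: the displayed `Set.Subsingleton` formula. [folklore] -/
lemma irredChamberAt_iff :
    X.IrredChamberAt d 𝔇 t ↔
      {C ∈ irreducibleComponents X.Pt | C ⊆ X.typeStratum t ∧
          ¬ C ⊆ closure {x | X.IsBorelValuedAt d x} ∧
          ∃ x ∈ C ∩ X.regular, X.IsCrystallineAt 𝔇 x ∧ X.IsHodgeTateRegularAt 𝔇 x ∧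
            X.IsStrictlyDominantAt x ∧ X.IsPhiGenericAt 𝔇 x}.Subsingleton :=
  Iff.rfl

/-- **Pairwise form**: `IrredChamberAt` says that two irreducible components of type `t`, neither
contained in `Z_B`, each containing a seed, are equal. [folklore] -/
lemma irredChamberAt_iff_forall_eq :
    X.IrredChamberAt d 𝔇 t ↔
      ∀ ⦃C₁ : Set X.Pt⦄, C₁ ∈ irreducibleComponents X.Pt → C₁ ⊆ X.typeStratum t →
        ¬ C₁ ⊆ closure {x | X.IsBorelValuedAt d x} →
        (∃ x ∈ C₁ ∩ X.regular, X.IsCrystallineAt 𝔇 x ∧ X.IsHodgeTateRegularAt 𝔇 x ∧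
            X.IsStrictlyDominantAt x ∧ X.IsPhiGenericAt 𝔇 x) →
      ∀ ⦃C₂ : Set X.Pt⦄, C₂ ∈ irreducibleComponents X.Pt → C₂ ⊆ X.typeStratum t →
        ¬ C₂ ⊆ closure {x | X.IsBorelValuedAt d x} →
        (∃ x ∈ C₂ ∩ X.regular, X.IsCrystallineAt 𝔇 x ∧ X.IsHodgeTateRegularAt 𝔇 x ∧
            X.IsStrictlyDominantAt x ∧ X.IsPhiGenericAt 𝔇 x) →
        C₁ = C₂ := by
  constructor
  · intro h C₁ h₁ h₁t h₁B h₁s C₂ h₂ h₂t h₂B h₂s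
    exact h ⟨h₁, h₁t, h₁B, h₁s⟩ ⟨h₂, h₂t, h₂B, h₂s⟩
  · intro h C₁ h₁ C₂ h₂
    exact h h₁.1 h₁.2.1 h₁.2.2.1 h₁.2.2.2 h₂.1 h₂.2.1 h₂.2.2.1 h₂.2.2.2

variable {X d 𝔇 t} in
/-- **Elimination rule** (the form a consumer of `(hIRR : ∀ t, X.IrredChamberAt d 𝔇 t)` applies):
two irreducible components of type `t`, not contained in `Z_B`, each with a seed, coincide.
[folklore] -/
theorem IrredChamberAt.eq (h : X.IrredChamberAt d 𝔇 t) {C₁ C₂ : Set X.Pt}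
    (h₁ : C₁ ∈ irreducibleComponents X.Pt) (h₂ : C₂ ∈ irreducibleComponents X.Pt)
    (h₁t : C₁ ⊆ X.typeStratum t) (h₂t : C₂ ⊆ X.typeStratum t)
    (h₁B : ¬ C₁ ⊆ closure {x | X.IsBorelValuedAt d x})
    (h₂B : ¬ C₂ ⊆ closure {x | X.IsBorelValuedAt d x})
    (h₁s : ∃ x ∈ C₁ ∩ X.regular, X.IsCrystallineAt 𝔇 x ∧ X.IsHodgeTateRegularAt 𝔇 x ∧
      X.IsStrictlyDominantAt x ∧ X.IsPhiGenericAt 𝔇 x)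
    (h₂s : ∃ x ∈ C₂ ∩ X.regular, X.IsCrystallineAt 𝔇 x ∧ X.IsHodgeTateRegularAt 𝔇 x ∧
      X.IsStrictlyDominantAt x ∧ X.IsPhiGenericAt 𝔇 x) :
    C₁ = C₂ :=
  h ⟨h₁, h₁t, h₁B, h₁s⟩ ⟨h₂, h₂t, h₂B, h₂s⟩

end Unfolding

/-! #### The type of a component is the type of any of its points -/

/-- An irreducible component `C` lies in the type stratum `X_t` iff one (any) of its points has
torsion type `t` — every component lies over a single type
(`exists_subset_typeStratum_of_mem_irreducibleComponents`); so "the chamber of type `t` through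
the seed `x`" just means `X.torsionType x = t`. [folklore] -/
theorem subset_typeStratum_iff_torsionType_eq {C : Set X.Pt} (hC : C ∈ irreducibleComponents X.Pt)
    {x : X.Pt} (hx : x ∈ C) (t : Fin n → (CommGroup.torsion Kˣ →* (PadicAlgCl p)ˣ)) :
    C ⊆ X.typeStratum t ↔ X.torsionType x = t := by
  refine ⟨fun h => h hx, fun h => ?_⟩
  obtain ⟨t', ht'⟩ := X.exists_subset_typeStratum_of_mem_irreducibleComponents hC
  have hxt' : X.torsionType x = t' := ht' hx
  obtain rfl : t' = t := hxt'.symm.trans h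
  exact ht'

/-! #### Vacuity and monotonicity -/

section Vacuity

variable (d : LocalArtinData K) (𝔇 : PstWeilDeligneData K p)
  (t : Fin n → (CommGroup.torsion Kˣ →* (PadicAlgCl p)ˣ))

/-- **Vacuity: no seed of type `t`.**  If no regular point of the stratum `X_t` is a seed
(crystalline, Hodge–Tate regular, strictly dominant, `φ`-generic), the defining set is empty and
`IrredChamberAt` holds. [folklore] -/
theorem irredChamberAt_of_forall_not_seed
    (h : ∀ x ∈ X.typeStratum t, x ∈ X.regular → X.IsCrystallineAt 𝔇 x →
      X.IsHodgeTateRegularAt 𝔇 x → X.IsStrictlyDominantAt x → ¬ X.IsPhiGenericAt 𝔇 x) :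
    X.IrredChamberAt d 𝔇 t := by
  intro C₁ h₁
  obtain ⟨-, h₁t, -, x, ⟨hxC, hxr⟩, hc, hHT, hsd, hφ⟩ := h₁
  exact (h x (h₁t hxC) hxr hc hHT hsd hφ).elim

/-- **Vacuity: empty type stratum** (e.g. the determinant-incompatible torsion types, over which
`X_tri^□(ρ̄)` has no point). [folklore] -/
theorem irredChamberAt_of_typeStratum_eq_empty (h : X.typeStratum t = ∅) :
    X.IrredChamberAt d 𝔇 t :=
  X.irredChamberAt_of_forall_not_seed d 𝔇 t fun x hx => by
    rw [h] at hx
    exact absurd hx (Set.notMem_empty x)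

/-- **Vacuity: the whole stratum `X_t` lies in the Borel-valued closure `Z_B`** (then no component
of type `t` escapes `Z_B`). [folklore] -/
theorem irredChamberAt_of_typeStratum_subset_closure
    (h : X.typeStratum t ⊆ closure {x | X.IsBorelValuedAt d x}) : X.IrredChamberAt d 𝔇 t := by
  intro C₁ h₁
  exact (h₁.2.2.1 (h₁.2.1.trans h)).elim

/-- **Monotonicity: at most one irreducible component over `t` suffices** (`Set.Subsingleton` is
antitone). [folklore] -/
theorem irredChamberAt_of_subsingleton
    (h : {C ∈ irreducibleComponents X.Pt | C ⊆ X.typeStratum t}.Subsingleton) :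
    X.IrredChamberAt d 𝔇 t :=
  h.anti fun _ hC => ⟨hC.1, hC.2.1⟩

/-- If the (clopen) stratum `X_t` is preirreducible — irreducible or empty — then it contains at
most one irreducible component of `X.Pt` (a component inside the irreducible closed set `X_t`
equals it, by maximality). [folklore] -/
theorem subsingleton_components_of_isPreirreducible_typeStratum
    (h : IsPreirreducible (X.typeStratum t)) :
    {C ∈ irreducibleComponents X.Pt | C ⊆ X.typeStratum t}.Subsingleton := by
  have key : ∀ {C : Set X.Pt}, C ∈ irreducibleComponents X.Pt → C ⊆ X.typeStratum t →
      C = X.typeStratum t :=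
    fun hC hCt => Maximal.eq_of_subset hC ⟨hC.1.nonempty.mono hCt, h⟩ hCt
  intro C₁ h₁ C₂ h₂
  exact (key h₁.1 h₁.2).trans (key h₂.1 h₂.2).symm

/-- **An irreducible (or empty) stratum `X_t` satisfies `IrredChamberAt` at `t`** whatever `d`, `𝔇`.
[folklore] -/
theorem irredChamberAt_of_isPreirreducible_typeStratum (h : IsPreirreducible (X.typeStratum t)) :
    X.IrredChamberAt d 𝔇 t :=
  X.irredChamberAt_of_subsingleton d 𝔇 t
    (X.subsingleton_components_of_isPreirreducible_typeStratum t h)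

end Vacuity

/-! #### Reformulations under `BorelLocusClopen` and when `Z_B = ∅` -/

section Borel

variable {X}
variable {d : LocalArtinData K} (𝔇 : PstWeilDeligneData K p)
  (t : Fin n → (CommGroup.torsion Kˣ →* (PadicAlgCl p)ˣ))

/-- Under `BorelLocusClopen d`, an irreducible component is NOT contained in the Borel-valued
closure `Z_B` iff it is DISJOINT from it (dichotomy `subset_or_disjoint_of_borelLocusClopen`;
components are nonempty). [folklore] -/
theorem not_subset_closure_iff_disjoint_of_borelLocusClopen (h : X.BorelLocusClopen d)
    {C : Set X.Pt} (hC : C ∈ irreducibleComponents X.Pt) :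
    ¬ C ⊆ closure {x | X.IsBorelValuedAt d x} ↔
      Disjoint C (closure {x | X.IsBorelValuedAt d x}) := by
  refine ⟨fun hn => (X.subset_or_disjoint_of_borelLocusClopen h hC).resolve_left hn,
    fun hd hs => ?_⟩
  obtain ⟨x, hx⟩ := hC.1.nonempty
  exact Set.disjoint_left.mp hd hx (hs hx)

/-- Under `BorelLocusClopen d` (`Z_B` = the slope-zero locus), a point lies outside `Z_B` iff it
has positive slope (`¬ IsSlopeZeroAt`). [folklore] -/
theorem notMem_closure_iff_not_isSlopeZeroAt_of_borelLocusClopen (h : X.BorelLocusClopen d)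
    (x : X.Pt) : x ∉ closure {x | X.IsBorelValuedAt d x} ↔ ¬ X.IsSlopeZeroAt x := by
  rw [h.2, Set.mem_setOf_eq]

/-- **Reformulation under `BorelLocusClopen` (requested).**  `IrredChamberAt d 𝔇 t` iff at most
one irreducible component of `X.Pt` contained in `X_t`, DISJOINT from `Z_B`, carries a seed — the
form "`X_tri^□(ρ̄) = Z_B ⊔ X_{>0}` componentwise, one seeded positive-slope chamber per type".
[folklore] -/
theorem irredChamberAt_iff_of_borelLocusClopen (h : X.BorelLocusClopen d) :
    X.IrredChamberAt d 𝔇 t ↔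
      {C ∈ irreducibleComponents X.Pt | C ⊆ X.typeStratum t ∧
          Disjoint C (closure {x | X.IsBorelValuedAt d x}) ∧
          ∃ x ∈ C ∩ X.regular, X.IsCrystallineAt 𝔇 x ∧ X.IsHodgeTateRegularAt 𝔇 x ∧
            X.IsStrictlyDominantAt x ∧ X.IsPhiGenericAt 𝔇 x}.Subsingleton := by
  have hset :
      {C ∈ irreducibleComponents X.Pt | C ⊆ X.typeStratum t ∧
          ¬ C ⊆ closure {x | X.IsBorelValuedAt d x} ∧
          ∃ x ∈ C ∩ X.regular, X.IsCrystallineAt 𝔇 x ∧ X.IsHodgeTateRegularAt 𝔇 x ∧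
            X.IsStrictlyDominantAt x ∧ X.IsPhiGenericAt 𝔇 x} =
      {C ∈ irreducibleComponents X.Pt | C ⊆ X.typeStratum t ∧
          Disjoint C (closure {x | X.IsBorelValuedAt d x}) ∧
          ∃ x ∈ C ∩ X.regular, X.IsCrystallineAt 𝔇 x ∧ X.IsHodgeTateRegularAt 𝔇 x ∧
            X.IsStrictlyDominantAt x ∧ X.IsPhiGenericAt 𝔇 x} := by
    ext C
    constructor
    · rintro ⟨hC, hCt, hCB, hCs⟩
      exact ⟨hC, hCt, (not_subset_closure_iff_disjoint_of_borelLocusClopen h hC).mp hCB, hCs⟩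
    · rintro ⟨hC, hCt, hCB, hCs⟩
      exact ⟨hC, hCt, (not_subset_closure_iff_disjoint_of_borelLocusClopen h hC).mpr hCB, hCs⟩
  rw [irredChamberAt_iff, hset]

/-- **Positive-slope seed form under `BorelLocusClopen`.**  `IrredChamberAt d 𝔇 t` iff at most one
irreducible component of type `t` contains a seed of POSITIVE SLOPE (`¬ IsSlopeZeroAt`): a
component with a point outside the clopen `Z_B` is disjoint from it, and conversely. [folklore] -/
theorem irredChamberAt_iff_slope_of_borelLocusClopen (h : X.BorelLocusClopen d) :
    X.IrredChamberAt d 𝔇 t ↔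
      {C ∈ irreducibleComponents X.Pt | C ⊆ X.typeStratum t ∧
          ∃ x ∈ C ∩ X.regular, ¬ X.IsSlopeZeroAt x ∧ X.IsCrystallineAt 𝔇 x ∧
            X.IsHodgeTateRegularAt 𝔇 x ∧ X.IsStrictlyDominantAt x ∧
            X.IsPhiGenericAt 𝔇 x}.Subsingleton := by
  have hset :
      {C ∈ irreducibleComponents X.Pt | C ⊆ X.typeStratum t ∧
          ¬ C ⊆ closure {x | X.IsBorelValuedAt d x} ∧
          ∃ x ∈ C ∩ X.regular, X.IsCrystallineAt 𝔇 x ∧ X.IsHodgeTateRegularAt 𝔇 x ∧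
            X.IsStrictlyDominantAt x ∧ X.IsPhiGenericAt 𝔇 x} =
      {C ∈ irreducibleComponents X.Pt | C ⊆ X.typeStratum t ∧
          ∃ x ∈ C ∩ X.regular, ¬ X.IsSlopeZeroAt x ∧ X.IsCrystallineAt 𝔇 x ∧
            X.IsHodgeTateRegularAt 𝔇 x ∧ X.IsStrictlyDominantAt x ∧
            X.IsPhiGenericAt 𝔇 x} := by
    ext C
    constructor
    · rintro ⟨hC, hCt, hCB, x, hx, hxs⟩
      have hd := (not_subset_closure_iff_disjoint_of_borelLocusClopen h hC).mp hCB
      exact ⟨hC, hCt, x, hx,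
        (notMem_closure_iff_not_isSlopeZeroAt_of_borelLocusClopen h x).mp
          (Set.disjoint_left.mp hd hx.1), hxs⟩
    · rintro ⟨hC, hCt, x, hx, hx0, hxs⟩
      exact ⟨hC, hCt, fun hs =>
        (notMem_closure_iff_not_isSlopeZeroAt_of_borelLocusClopen h x).mpr hx0 (hs hx.1),
        x, hx, hxs⟩
  rw [irredChamberAt_iff, hset]

/-- **No Borel-valued points (`Z_B = ∅`, e.g. `ρ̄` irreducible: no lift is reducible).**  Then the
`Z_B`-clause is vacuous and `IrredChamberAt d 𝔇 t` iff at most one irreducible component of type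
`t` carries a seed — the shape of the crux `ChamberQpIrreducible`. [folklore] -/
theorem irredChamberAt_iff_of_forall_not_isBorelValuedAt (hB : ∀ x, ¬ X.IsBorelValuedAt d x) :
    X.IrredChamberAt d 𝔇 t ↔
      {C ∈ irreducibleComponents X.Pt | C ⊆ X.typeStratum t ∧
          ∃ x ∈ C ∩ X.regular, X.IsCrystallineAt 𝔇 x ∧ X.IsHodgeTateRegularAt 𝔇 x ∧
            X.IsStrictlyDominantAt x ∧ X.IsPhiGenericAt 𝔇 x}.Subsingleton := by
  have hZ : closure {x | X.IsBorelValuedAt d x} = ∅ := by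
    rw [closure_empty_iff, Set.eq_empty_iff_forall_notMem]
    exact hB
  have hset :
      {C ∈ irreducibleComponents X.Pt | C ⊆ X.typeStratum t ∧
          ¬ C ⊆ closure {x | X.IsBorelValuedAt d x} ∧
          ∃ x ∈ C ∩ X.regular, X.IsCrystallineAt 𝔇 x ∧ X.IsHodgeTateRegularAt 𝔇 x ∧
            X.IsStrictlyDominantAt x ∧ X.IsPhiGenericAt 𝔇 x} =
      {C ∈ irreducibleComponents X.Pt | C ⊆ X.typeStratum t ∧
          ∃ x ∈ C ∩ X.regular, X.IsCrystallineAt 𝔇 x ∧ X.IsHodgeTateRegularAt 𝔇 x ∧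
            X.IsStrictlyDominantAt x ∧ X.IsPhiGenericAt 𝔇 x} := by
    ext C
    constructor
    · rintro ⟨hC, hCt, -, hCs⟩
      exact ⟨hC, hCt, hCs⟩
    · rintro ⟨hC, hCt, hCs⟩
      refine ⟨hC, hCt, fun hs => ?_, hCs⟩
      rw [hZ, Set.subset_empty_iff] at hs
      exact hC.1.nonempty.ne_empty hs
  rw [irredChamberAt_iff, hset]

end Borel

end TriangulineVariety

end Literature.NumberTheory.GaloisRepresentations
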